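import Summits.HubbardSuperconductivity.HubbardSuperconductivity.Theorems.BalabanIRBirEveryGroundStateSchur
import Literature.MathematicalPhysics.QuantumLattice.ApproximateEigenvectorLemmas
import HarnessLib

/-!
# Crux `JmPairBridge` (stmt-HubbardSuperconductivity-2226), line `Sketch` (Schur landing):
# stub `stub_schurBridge` — Schur rigidity of the bridge Gram operator (abstract)

Route `JosephsonMirror`, crux `JmPairBridge`. ABSTRACT finite-dimensional linear algebra: two subspaces
`F`, `Fm` of `ℂⁿ` (the adjacent ground floors), a matrix `Δ` (the pair field), a family `S` of unitaries
each preserving `F` and `Fm` together with its adjoint and twisting `Δ` by a unimodular phase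
(`X Δ = ω Δ X`). Then `A := Δᴴ P Δ`, `P` the orthogonal projection onto `Fm`, commutes with every
`X ∈ S`; if `F` is `S`-irreducible, Schur's lemma (`exists_scalar_matrixElements_of_irreducible`) gives
`⟨w, A v⟩ = μ ⟨w, v⟩` on `F`, i.e. `‖P Δ φ‖² = μ` for every unit `φ ∈ F`. One bridged unit pair
`φ₀ ∈ F`, `χ₀ ∈ Fm`, `t ≤ |⟨χ₀, Δ φ₀⟩|² ≤ ‖P Δ φ₀‖² = μ` (Bessel), and then for every unit `φ ∈ F` the
unit vector `χ := P Δ φ / ‖P Δ φ‖ ∈ Fm` has `|⟨χ, Δ φ⟩|² = ‖P Δ φ‖² = μ ≥ t` (if `μ = 0`, `t ≤ 0` and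
`χ := χ₀` serves).

Sources: J.-P. Serre, *Linear Representations of Finite Groups* §2.2 Prop. 4 (Schur); H. Tasaki,
*Physics and Mathematics of Quantum Many-Body Systems* (2020) App. A.2 (projections). Folklore; no
definition, no named fact.
-/

noncomputable section

-- the mandated namespace `Summit.<Summit>.<Problem>.Theorems` repeats `HubbardSuperconductivity`
-- (single-problem summit, D-0017), which the `dupNamespace` linter flags on every declaration
set_option linter.dupNamespace false

namespace Summit.HubbardSuperconductivity.HubbardSuperconductivity.Theorems.JosephsonMirror

open Matrix Literature.MathematicalPhysics.QuantumLattice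
open scoped ComplexOrder

/-- **STUB `stub_schurBridge`** (abstract; Schur rigidity of the bridge Gram operator). `F`, `Fm` two
subspaces, `S` a family of unitaries each of which, together with its adjoint, preserves `F` and `Fm`,
and twists `Δ` by a unimodular phase. If `F` has no `S`-invariant subspace other than `⊥` and `F`, then
ONE pair of unit vectors `φ₀ ∈ F`, `χ₀ ∈ Fm` with `t ≤ |⟨χ₀, Δ φ₀⟩|²` forces, for EVERY unit `φ ∈ F`, a
unit `χ ∈ Fm` with `t ≤ |⟨χ, Δ φ⟩|²`. (Schur for `Δᴴ P_{Fm} Δ` compressed to `F`.)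
Serre, *Linear Representations of Finite Groups* §2.2. [folklore] -/
theorem stub_schurBridge {n : Type*} [Fintype n] [DecidableEq n]
    (Δ : Matrix n n ℂ) (F Fm : Submodule ℂ (n → ℂ)) (S : Set (Matrix n n ℂ))
    (hSU : ∀ X ∈ S, Xᴴ * X = 1)
    (hSF : ∀ X ∈ S, ∀ v ∈ F, X *ᵥ v ∈ F) (hSF' : ∀ X ∈ S, ∀ v ∈ F, Xᴴ *ᵥ v ∈ F)
    (hSFm : ∀ X ∈ S, ∀ v ∈ Fm, X *ᵥ v ∈ Fm) (hSFm' : ∀ X ∈ S, ∀ v ∈ Fm, Xᴴ *ᵥ v ∈ Fm)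
    (hSΔ : ∀ X ∈ S, ∃ ω : ℂ, ‖ω‖ = 1 ∧ X * Δ = ω • (Δ * X))
    (hirr : ∀ K' : Submodule ℂ (n → ℂ), K' ≤ F → (∀ X ∈ S, ∀ v ∈ K', X *ᵥ v ∈ K') →
      K' = ⊥ ∨ K' = F)
    (t : ℝ)
    (hsome : ∃ φ₀ ∈ F, ∃ χ₀ ∈ Fm, star φ₀ ⬝ᵥ φ₀ = 1 ∧ star χ₀ ⬝ᵥ χ₀ = 1 ∧
      t ≤ ‖star χ₀ ⬝ᵥ (Δ *ᵥ φ₀)‖ ^ 2) :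
    ∀ φ ∈ F, star φ ⬝ᵥ φ = 1 → ∃ χ ∈ Fm, star χ ⬝ᵥ χ = 1 ∧ t ≤ ‖star χ ⬝ᵥ (Δ *ᵥ φ)‖ ^ 2 := by
  -- the orthogonal projection onto `Fm` and its elementary algebra
  set P : Matrix n n ℂ := projMatrix (Fm.map ((WithLp.linearEquiv 2 ℂ (n → ℂ)).symm :
      (n → ℂ) →ₗ[ℂ] EuclideanSpace ℂ n))
  have hPH : P.IsHermitian := projMatrix_isHermitian _
  have hPmem : ∀ x, P *ᵥ x ∈ Fm := fun x => projMatrix_map_mulVec_mem Fm x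
  have hPfix : ∀ x ∈ Fm, P *ᵥ x = x := fun x hx => projMatrix_map_mulVec_of_mem Fm hx
  have hPP : ∀ x, P *ᵥ (P *ᵥ x) = P *ᵥ x := fun x => hPfix _ (hPmem x)
  -- `⟨P x, y⟩ = ⟨P x, P y⟩`
  have hPdot : ∀ x y, star (P *ᵥ x) ⬝ᵥ y = star (P *ᵥ x) ⬝ᵥ (P *ᵥ y) := fun x y => by
    rw [← star_mulVec_dotProduct_of_isHermitian hPH (P *ᵥ x) y, hPP]
  -- the bridge Gram operator `A = Δᴴ P Δ`
  set A : Matrix n n ℂ := Δᴴ * P * Δ with hA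
  have hAv : ∀ v, A *ᵥ v = Δᴴ *ᵥ (P *ᵥ (Δ *ᵥ v)) := fun v => by
    simp only [hA, ← mulVec_mulVec]
  -- `⟨φ, A φ⟩ = ‖P Δ φ‖²`
  have hAgram : ∀ φ, star φ ⬝ᵥ A *ᵥ φ = star (P *ᵥ (Δ *ᵥ φ)) ⬝ᵥ (P *ᵥ (Δ *ᵥ φ)) := fun φ => by
    rw [hAv, ← star_mulVec_dotProduct Δ φ,
      ← star_mulVec_dotProduct_of_isHermitian hPH (Δ *ᵥ φ) (Δ *ᵥ φ)]
    exact hPdot _ _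
  -- every symmetry commutes with `A`
  have hSA : ∀ X ∈ S, X * A = A * X := by
    intro X hX
    obtain ⟨ω, hω, hXΔ⟩ := hSΔ X hX
    have hU : Xᴴ * X = 1 := hSU X hX
    have hU' : X * Xᴴ = 1 := mul_eq_one_comm.mp hU
    -- `X Δᴴ = ω̄ Δᴴ X`
    have hXΔ' : X * Δᴴ = star ω • (Δᴴ * X) := by
      have h1 : Δᴴ * Xᴴ = star ω • (Xᴴ * Δᴴ) := by
        have h := congrArg conjTranspose hXΔ
        rwa [conjTranspose_mul, conjTranspose_smul, conjTranspose_mul] at h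
      calc X * Δᴴ = X * (Δᴴ * Xᴴ) * X := by
            rw [Matrix.mul_assoc, Matrix.mul_assoc, hU, Matrix.mul_one]
        _ = star ω • (Δᴴ * X) := by
            rw [h1, Matrix.mul_smul, Matrix.smul_mul, ← Matrix.mul_assoc, hU', Matrix.one_mul]
    -- `P X = X P`
    have hPX : P * X = X * P := by
      refine Matrix.ext_iff_mulVec.mpr fun v => ?_
      rw [← mulVec_mulVec, ← mulVec_mulVec]
      exact projMatrix_map_mulVec_comm Fm (hSFm X hX) (hSFm' X hX) v
    have hωω : star ω * ω = 1 := by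
      rw [Complex.star_def, Complex.conj_mul', hω, Complex.ofReal_one, one_pow]
    calc X * A = X * Δᴴ * P * Δ := by simp only [hA, Matrix.mul_assoc]
      _ = star ω • (Δᴴ * (X * P) * Δ) := by
          rw [hXΔ']
          simp only [Matrix.smul_mul, Matrix.mul_assoc]
      _ = star ω • (Δᴴ * P * (X * Δ)) := by
          rw [← hPX]
          simp only [Matrix.mul_assoc]
      _ = (star ω * ω) • (A * X) := by
          rw [hXΔ, hA]
          simp only [Matrix.mul_smul, smul_smul, Matrix.mul_assoc]
      _ = A * X := by rw [hωω, one_smul]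
  -- Schur: `⟨w, A v⟩ = μ ⟨w, v⟩` on `F`, hence `‖P Δ φ‖² = re μ` for unit `φ ∈ F`
  obtain ⟨μ, hμ⟩ := exists_scalar_matrixElements_of_irreducible F A S hSA hSF hSF' hirr
  have hnormsq : ∀ φ ∈ F, star φ ⬝ᵥ φ = 1 → eucNorm (P *ᵥ (Δ *ᵥ φ)) ^ 2 = μ.re := by
    intro φ hφ hφ1
    rw [eucNorm_sq, ← hAgram, hμ φ hφ φ hφ, hφ1, mul_one]
  -- Bessel with the given bridged pair: `t ≤ re μ`
  obtain ⟨φ₀, hφ₀F, χ₀, hχ₀Fm, hφ₀1, hχ₀1, ht⟩ := hsome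
  have htμ : t ≤ μ.re := by
    have h1 : star χ₀ ⬝ᵥ (Δ *ᵥ φ₀) = star χ₀ ⬝ᵥ (P *ᵥ (Δ *ᵥ φ₀)) := by
      have h := hPdot χ₀ (Δ *ᵥ φ₀)
      rwa [hPfix χ₀ hχ₀Fm] at h
    have h2 : ‖star χ₀ ⬝ᵥ (Δ *ᵥ φ₀)‖ ≤ eucNorm (P *ᵥ (Δ *ᵥ φ₀)) := by
      rw [h1]
      exact norm_star_dotProduct_le_eucNorm hχ₀1 _
    have h3 : ‖star χ₀ ⬝ᵥ (Δ *ᵥ φ₀)‖ ^ 2 ≤ eucNorm (P *ᵥ (Δ *ᵥ φ₀)) ^ 2 :=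
      pow_le_pow_left₀ (norm_nonneg _) h2 2
    rw [hnormsq φ₀ hφ₀F hφ₀1] at h3
    exact ht.trans h3
  -- every unit `φ ∈ F`: normalise `P Δ φ ∈ Fm` (or fall back on `χ₀` if it vanishes)
  intro φ hφ hφ1
  have hw2 : eucNorm (P *ᵥ (Δ *ᵥ φ)) ^ 2 = μ.re := hnormsq φ hφ hφ1
  rcases eq_or_ne (eucNorm (P *ᵥ (Δ *ᵥ φ))) 0 with h0 | h0
  · refine ⟨χ₀, hχ₀Fm, hχ₀1, ?_⟩
    rw [h0] at hw2
    have hμ0 : μ.re = 0 := by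
      rw [← hw2]
      norm_num
    exact (htμ.trans_eq hμ0).trans (sq_nonneg _)
  · refine ⟨(((eucNorm (P *ᵥ (Δ *ᵥ φ)))⁻¹ : ℝ) : ℂ) • (P *ᵥ (Δ *ᵥ φ)),
      Fm.smul_mem _ (hPmem _), ?_, ?_⟩
    · rw [star_smul, smul_dotProduct, dotProduct_smul, star_dotProduct_self_eq_eucNorm_sq,
        smul_eq_mul, smul_eq_mul, Complex.star_def, Complex.conj_ofReal, ← Complex.ofReal_mul,
        ← Complex.ofReal_mul, ← Complex.ofReal_one, Complex.ofReal_inj]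
      field_simp
    · have e1 : star ((((eucNorm (P *ᵥ (Δ *ᵥ φ)))⁻¹ : ℝ) : ℂ) • (P *ᵥ (Δ *ᵥ φ))) ⬝ᵥ (Δ *ᵥ φ) =
          ((eucNorm (P *ᵥ (Δ *ᵥ φ)) : ℝ) : ℂ) := by
        rw [star_smul, smul_dotProduct, hPdot, star_dotProduct_self_eq_eucNorm_sq, smul_eq_mul,
          Complex.star_def, Complex.conj_ofReal, ← Complex.ofReal_mul, Complex.ofReal_inj]
        field_simp
      rw [e1, Complex.norm_real, Real.norm_of_nonneg (eucNorm_nonneg _), hw2]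
      exact htμ

end Summit.HubbardSuperconductivity.HubbardSuperconductivity.Theorems.JosephsonMirror

end
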